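import Literature.NumberTheory.GaloisRepresentations.WeilLAdicCharacterProofs
import Literature.NumberTheory.GaloisRepresentations.HeckeCharacterOfGrossencharakter
import Literature.NumberTheory.GaloisRepresentations.AbsGaloisGroupCompact
import Literature.NumberTheory.GaloisRepresentations.FramedRepBaseChange
import Literature.NumberTheory.GaloisRepresentations.ArtinCharacterReciprocity
import Literature.NumberTheory.EllipticCurves.NewformPadicIntegralModel
import HarnessLib

/-!
# Route `SignedLowerHalves`, crux L `SmallImageLowerHalfBothSigns` (item stmt-BirchSwinnertonDyer-23599), line `rtt_w3` —
# brick JD-b of the character road: INTEGRAL framing of a rank-one `p`-adic character, and the pinned character `θ = ψ_𝔭 : Γ_K → 𝒪ˣ`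
# over the integers `𝒪 = 𝒪_{ℚ_p(S)}` of a FINITE extension

LEAD `cruxlead-stmt-BirchSwinnertonDyer-23599` g5; helper `--supports stmt-BirchSwinnertonDyer-23599`; THEOREMS ONLY, no `sorry`; closes nothing;
BSD / crux L are not proved by this.

WHY. JD (the data conjunct of the v8 research stub `stub_charRoad_ns`) wants a coefficient set `S ⊆ ℚ̄_p` with `0 < [ℚ_p(S):ℚ_p] < ∞`, an
INTEGRAL character `θ : Γ_K → GL₁(𝒪_{ℚ_p(S)})` pinned to the Grössencharakter `ψ` by `θ.HasFrobCharpolyAt w P`, `P.map 𝒪.subtype = X − C(e⁻¹(ψ w))`,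
and the local transport `j` above `p` (row J). This file PROVES everything except row J:
* §1 `FramedRep.exists_baseChange_eq_of_forall_mem` — a continuous `ρ : G → GL₁(ℚ̄_p)` on a COMPACT group whose entries lie in `ℚ_p(S)` is the
  base change of a continuous `θ : G → GL₁(𝒪_{ℚ_p(S)})` (entries have norm `≤ 1` by the tree's `FramedRep.norm_le_one_of_isRoot_charpoly`; rank one,
  so the entry IS the representation);
* §2 ★ `exists_integralPinnedCharacter_of_isGrossencharakter` — for a Grössencharakter `ψ mod 𝔪` of a number field and `e : ℚ̄_p ≃ ℂ`: a set
  `S` with `0 < [ℚ_p(S):ℚ_p]` (Weil's field of values of the idelic lift of `ψ⁻¹`, `HeckeCharacter.lAdicValueField`, finite-dimensional and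
  complete — PROVED in the tree) and `θ : Γ_K → GL₁(𝒪_{ℚ_p(S)})` unramified at every `w ∤ p`, `𝔪 ≰ w`, with `θ(Frob_w^{arith}) = e⁻¹(ψ w)`
  (integral polynomial clause). Ingredients: `HeckeCharacter.exists_of_isGrossencharakter` (Neukirch VII (6.14)), Weil's construction
  `HasInfinityType.weilRep` with `rep_mem` / `tendsto_rep` (values in the closed field of values), §1, and the transport of the Galois
  predicates along the injective base change (`FramedGaloisRep.isUnramifiedAt_baseChange_iff`, `hasFrobCharpolyAt_iff_of_rank_one`).

References: [Weil1956] §1–§2; [SerreAbelianLadic1968] Ch. I §1.1, Ch. II §2.7; [NeukirchANT1999] Ch. VII §6 Cor. (6.14).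
-/

set_option autoImplicit false
-- D-0017: single-problem summit, the namespace repeats the problem name by design.
set_option linter.dupNamespace false
noncomputable section

open scoped NumberField MatrixGroups Topology
open NumberField IsDedekindDomain Polynomial Field Filter
  Literature.NumberTheory.GaloisRepresentations Literature.NumberTheory.LFunctions
  Literature.NumberTheory.EllipticCurves

namespace Summit.BirchSwinnertonDyer.BirchSwinnertonDyer.Theorems.SmallImageRttCharRoad

/-! ## §1 Integral framing of a rank-one character with values in `ℚ_p(S)` -/

section Framing

variable {p : ℕ} [Fact p.Prime] {G : Type*} [Group G] [TopologicalSpace G]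

/-- The `(0,0)` entry of a rank-one framed representation is multiplicative. [folklore] -/
theorem apply_zero_zero_mul {A : Type*} [CommRing A] [TopologicalSpace A] (ρ : FramedRep G A 1) (g h : G) :
    ((ρ (g * h) : GL (Fin 1) A) : Matrix (Fin 1) (Fin 1) A) 0 0 =
      ((ρ g : GL (Fin 1) A) : Matrix (Fin 1) (Fin 1) A) 0 0 * ((ρ h : GL (Fin 1) A) : Matrix (Fin 1) (Fin 1) A) 0 0 := by
  rw [map_mul, Units.val_mul, Matrix.mul_apply, Fin.sum_univ_one]

/-- The `(0,0)` entry of a rank-one framed representation at `1` is `1`. [folklore] -/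
theorem apply_zero_zero_one {A : Type*} [CommRing A] [TopologicalSpace A] (ρ : FramedRep G A 1) :
    ((ρ 1 : GL (Fin 1) A) : Matrix (Fin 1) (Fin 1) A) 0 0 = 1 := by
  rw [map_one, Units.val_one, Matrix.one_apply_eq]

/-- Powers: the `(0,0)` entry of `ρ(g^k)` is the `k`-th power of that of `ρ(g)` (rank one). [folklore] -/
theorem apply_zero_zero_pow {A : Type*} [CommRing A] [TopologicalSpace A] (ρ : FramedRep G A 1) (g : G) (k : ℕ) :
    ((ρ (g ^ k) : GL (Fin 1) A) : Matrix (Fin 1) (Fin 1) A) 0 0 = (((ρ g : GL (Fin 1) A) : Matrix (Fin 1) (Fin 1) A) 0 0) ^ k := by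
  induction k with
  | zero => rw [pow_zero, pow_zero, apply_zero_zero_one]
  | succ k ih => rw [pow_succ, apply_zero_zero_mul, ih, pow_succ]

/-- **The entries of a continuous rank-one character of a compact group over a normed field have norm `≤ 1`**: the image is compact, hence
bounded, and contains all powers of the entry. [cite: SerreAbelianLadic1968, Ch. I §1.1] -/
theorem norm_apply_zero_zero_le_one [CompactSpace G] {A : Type*} [NormedField A] (ρ : FramedRep G A 1) (g : G) :
    ‖((ρ g : GL (Fin 1) A) : Matrix (Fin 1) (Fin 1) A) 0 0‖ ≤ 1 := by
  set a : G → A := fun g => ((ρ g : GL (Fin 1) A) : Matrix (Fin 1) (Fin 1) A) 0 0 with ha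
  have hcont : Continuous a := (Units.continuous_val.comp (map_continuous ρ)).matrix_elem 0 0
  obtain ⟨C, hC⟩ := isCompact_univ.exists_bound_of_continuousOn hcont.continuousOn
  by_contra hlt
  rw [not_le] at hlt
  obtain ⟨k, hk⟩ := pow_unbounded_of_one_lt C hlt
  have h1 : ‖a (g ^ k)‖ ≤ C := hC (g ^ k) (Set.mem_univ _)
  rw [show a (g ^ k) = a g ^ k from apply_zero_zero_pow ρ g k, norm_pow] at h1
  exact absurd hk (not_lt.mpr h1)

/-- **Integral framing in rank one.** A continuous `ρ : G → GL₁(ℚ̄_p)` on a compact group all of whose entries lie in the subfield `ℚ_p(S)`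
is the base change along `𝒪_{ℚ_p(S)} ⊆ ℚ̄_p` of a continuous `θ : G → GL₁(𝒪_{ℚ_p(S)})` (`𝒪_{ℚ_p(S)} = {x ∈ ℚ_p(S) : ‖x‖ ≤ 1}`,
`padicCoeffIntegers S`). [cite: SerreAbelianLadic1968, Ch. I §1.1] -/
theorem FramedRep.exists_baseChange_eq_of_forall_mem [IsTopologicalGroup G] [CompactSpace G]
    (ρ : FramedRep G (PadicAlgCl p) 1) (S : Set (PadicAlgCl p))
    (hmem : ∀ g : G, ((ρ g : GL (Fin 1) (PadicAlgCl p)) : Matrix (Fin 1) (Fin 1) (PadicAlgCl p)) 0 0 ∈ padicCoeffField S) :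
    ∃ θ : FramedRep G (padicCoeffIntegers S) 1,
      FramedRep.baseChange (padicCoeffIntegers S).subtype continuous_subtype_val θ = ρ := by
  -- the entry `a g` and its membership in `𝒪`
  set a : G → PadicAlgCl p := fun g => ((ρ g : GL (Fin 1) (PadicAlgCl p)) : Matrix (Fin 1) (Fin 1) (PadicAlgCl p)) 0 0 with ha
  have hmul : ∀ g h, a (g * h) = a g * a h := fun g h => apply_zero_zero_mul ρ g h
  have hone : a 1 = 1 := apply_zero_zero_one ρ
  have hinv : ∀ g, a g * a g⁻¹ = 1 := fun g => by rw [← hmul, mul_inv_cancel, hone]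
  have hO : ∀ g, a g ∈ padicCoeffIntegers S := fun g => ⟨hmem g, norm_apply_zero_zero_le_one ρ g⟩
  have hcont : Continuous a := (Units.continuous_val.comp (map_continuous ρ)).matrix_elem 0 0
  -- the units-valued homomorphism into `𝒪ˣ`
  let u : G →* (padicCoeffIntegers S)ˣ :=
    { toFun := fun g => ⟨⟨a g, hO g⟩, ⟨a g⁻¹, hO g⁻¹⟩, Subtype.ext (hinv g),
        Subtype.ext (by rw [Subring.coe_mul, mul_comm]; exact hinv g)⟩
      map_one' := Units.ext (Subtype.ext hone)
      map_mul' := fun g h => Units.ext (Subtype.ext (hmul g h)) }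
  have hu : Continuous u := by
    refine Units.continuous_iff.mpr ⟨?_, ?_⟩
    · exact (hcont.subtype_mk fun g => hO g)
    · have : (fun g => ((u g)⁻¹ : (padicCoeffIntegers S)ˣ).val) = fun g => (⟨a g⁻¹, hO g⁻¹⟩ : padicCoeffIntegers S) := rfl
      rw [this]
      exact (hcont.comp continuous_inv).subtype_mk fun g => hO g⁻¹
  refine ⟨(FramedRep.unitsContinuousMulEquivOfUnique (Fin 1) (padicCoeffIntegers S) :
      (padicCoeffIntegers S)ˣ →ₜ* GL (Fin 1) (padicCoeffIntegers S)).comp ⟨u, hu⟩, ?_⟩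
  refine ContinuousMonoidHom.ext fun g => Units.ext ?_
  ext i j
  rw [Fin.eq_zero i, Fin.eq_zero j, FramedRep.coe_baseChange_apply, Matrix.map_apply]
  rfl

end Framing

/-! ## §2 The integral pinned character of a Grössencharakter -/

/-- ★ **JD-b: the integral pinned `p`-adic character of a Grössencharakter.** For a Grössencharakter `ψ mod 𝔪` (`𝔪 ≠ 0`, type `(a,b)`) of a
number field `K`, a prime `p` and `e : ℚ̄_p ≃ ℂ`, there are a set `S ⊆ ℚ̄_p` with `0 < [ℚ_p(S):ℚ_p]` (so `ℚ_p(S)/ℚ_p` is finite) and a continuous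
INTEGRAL character `θ : Γ_K → GL₁(𝒪_{ℚ_p(S)})` which at every `w ∤ p` with `𝔪 ≰ w` is unramified with arithmetic-Frobenius characteristic
polynomial `P`, `P.map 𝒪.subtype = X − e⁻¹(ψ(w))` — Weil's character of `ψ⁻¹`, whose values lie in Weil's (finite, complete) field of values,
framed integrally by §1. This is JD of the v8 stub minus row J. [cite: Weil1956, §1–§2] [cite: SerreAbelianLadic1968, Ch. II §2.7]
[cite: NeukirchANT1999, Ch. VII §6 Cor. (6.14)] -/
theorem exists_integralPinnedCharacter_of_isGrossencharakter {K : Type} [Field K] [NumberField K] {𝔪 : Ideal (𝓞 K)}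
    (h𝔪 : 𝔪 ≠ ⊥) {a b : InfinitePlace K → ℤ} {ψ : HeightOneSpectrum (𝓞 K) → ℂ} (hψ : IsGrossencharakter 𝔪 a b ψ)
    {p : ℕ} [Fact p.Prime] (e : PadicAlgCl p ≃+* ℂ) :
    ∃ S : Set (PadicAlgCl p), 0 < Module.finrank ℚ_[p] (padicCoeffField S) ∧
      ∃ θ : FramedGaloisRep K (padicCoeffIntegers S) 1, ∀ v : HeightOneSpectrum (𝓞 K),
        ((p : ℕ) : 𝓞 K) ∉ v.asIdeal → ¬ 𝔪 ≤ v.asIdeal →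
          θ.IsUnramifiedAt v ∧ ∃ P : Polynomial (padicCoeffIntegers S),
            P.map (padicCoeffIntegers S).subtype = X - C (e.symm (ψ v)) ∧ θ.HasFrobCharpolyAt v P := by
  haveI : CompactSpace (absoluteGaloisGroup K) := absoluteGaloisGroup_compactSpace K
  -- `ψ⁻¹` is a Grössencharakter mod `𝔪` of type `(-a, -b)`
  have hpow : ∀ I : Ideal (𝓞 K), idealPow K (fun v => (ψ v)⁻¹) I = (idealPow K ψ I)⁻¹ := fun I => by
    rw [idealPow, idealPow, ← finprod_inv_distrib]
    exact finprod_congr fun v => inv_pow _ _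
  have hinv : IsGrossencharakter 𝔪 (fun w => -a w) (fun w => -b w) (fun v => (ψ v)⁻¹) := by
    refine ⟨fun v hv => inv_ne_zero (hψ.ne_zero v hv), fun c d hc hd hcop hcd hpos => ?_⟩
    rw [hpow, hpow, hψ.idealPow_span_eq c d hc hd hcop hcd hpos, mul_inv, ← Finset.prod_inv_distrib]
    refine congrArg _ (Finset.prod_congr rfl fun w _ => ?_)
    rw [mul_inv, zpow_neg, zpow_neg]
  -- the idelic lift `ω` of `ψ⁻¹`, its module of definition, Weil's character `r = weilRep`
  obtain ⟨ω, hinf, hω⟩ := HeckeCharacter.exists_of_isGrossencharakter h𝔪 hinv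
  obtain ⟨ex, hmod⟩ := ω.exists_isModulus_of_ramified
  set T := (HeckeCharacter.finite_ramifiedPlaces_holds ω).toFinset with hT
  set S := HeckeCharacter.lAdicValueGens ω e T ex with hS
  haveI hfd : FiniteDimensional ℚ_[p] (padicCoeffField S) := HeckeCharacter.finiteDimensional_lAdicValueField ω e T ex
  -- the values of Weil's character lie in the (closed) field of values
  have hclosed : IsClosed ((padicCoeffField S : IntermediateField ℚ_[p] (PadicAlgCl p)) : Set (PadicAlgCl p)) :=
    (HeckeCharacter.isComplete_lAdicValueField ω e T ex).isClosed
  have hval : ∀ σ : absoluteGaloisGroup K, hinf.weilValue hmod e σ ∈ padicCoeffField S := fun σ =>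
    hclosed.mem_of_tendsto (hinf.tendsto_rep hmod e σ) (Eventually.of_forall fun N => hinf.rep_mem hmod e N σ)
  have hmem : ∀ σ : absoluteGaloisGroup K,
      ((hinf.weilRep hmod e σ : GL (Fin 1) (PadicAlgCl p)) : Matrix (Fin 1) (Fin 1) (PadicAlgCl p)) 0 0 ∈ padicCoeffField S := fun σ => by
    rw [hinf.weilRep_apply_coe hmod e σ 0 0]
    exact inv_mem (hval σ)
  obtain ⟨θ, hθ⟩ := FramedRep.exists_baseChange_eq_of_forall_mem (hinf.weilRep hmod e) S hmem
  refine ⟨S, Module.finrank_pos, θ, fun v hvp hv => ?_⟩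
  obtain ⟨hunr, hvalv⟩ := hω v hv
  have hvT : v ∉ T := fun h => ((HeckeCharacter.finite_ramifiedPlaces_holds ω).mem_toFinset.mp h) hunr
  have h1 := hinf.isUnramifiedAt_weilRep hmod e hvT hvp
  have h2 := hinf.hasFrobCharpolyAt_weilRep hmod e hvT hvp
  rw [hvalv] at h2
  rw [← hθ] at h1 h2
  simp only [inv_inv] at h2
  refine ⟨(FramedGaloisRep.isUnramifiedAt_baseChange_iff _ _ Subtype.val_injective v θ).mp h1, ?_⟩
  -- the Frobenius value `e⁻¹(ψ v)` is an entry of `θ`, hence lies in `𝒪`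
  obtain ⟨𝔓, h𝔓⟩ := IsDedekindDomain.HeightOneSpectrum.primesAbove_nonempty v
  obtain ⟨Φ, hΦ⟩ := IsDedekindDomain.HeightOneSpectrum.exists_isArithFrobAt_of_mem_primesAbove_holds h𝔓
  have hentry := (FramedGaloisRep.hasFrobCharpolyAt_iff_of_rank_one _ v _).mp h2 𝔓 h𝔓 Φ hΦ
  rw [FramedRep.coe_baseChange_apply, Matrix.map_apply] at hentry
  refine ⟨X - C (((θ Φ : GL (Fin 1) (padicCoeffIntegers S)) : Matrix (Fin 1) (Fin 1) (padicCoeffIntegers S)) 0 0), ?_, ?_⟩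
  · rw [Polynomial.map_sub, map_X, map_C, hentry]
  · refine (FramedGaloisRep.hasFrobCharpolyAt_baseChange_iff (padicCoeffIntegers S).subtype continuous_subtype_val
      Subtype.val_injective v θ _).mp ?_
    rw [Polynomial.map_sub, map_X, map_C, hentry]
    exact h2

end Summit.BirchSwinnertonDyer.BirchSwinnertonDyer.Theorems.SmallImageRttCharRoad

end
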